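import Literature.AlgebraicGeometry.Frobenioids.CoAngular
import Literature.AlgebraicGeometry.Frobenioids.ArchimedeanDivisors
import Literature.AlgebraicGeometry.Frobenioids.ArchimedeanRegionCalculus
import Literature.AlgebraicGeometry.Frobenioids.ArchimedeanIsotropy
import HarnessLib

/-!
# Frobenioids II, Example 3.3 (i)(ii): the morphism typology of [FrdI] Def. 1.2 in `C₀`

Mochizuki, *The geometry of Frobenioids II: poly-Frobenioids*, Kyushu J. Math. **62** (2008)
401–460, §3, Example 3.3 (i)(ii), author's text pp. 27–28 [cite: MochizukiFrdII2008, Ex 3.3 (ii) p.28],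
read against [FrdI] Def. 1.2 (found's `PreFrobenioidMorphisms.lean`) for the pre-Frobenioid
`C₀ → F_{Φ₀}` of abc-iut-L1-t6 (`ArchimedeanDivisors.lean`: `C0.toElem`).  PROOF-ONLY file (no
definition): the dictionary between the abstract typology and the explicit data
`φ = (Base, deg_Fr, c)` of a morphism of `C₀` —
linear ⟺ `deg_Fr = 1`; isometric ⟺ `|c| · tip^{deg_Fr} = tip'`; base-isomorphism ⟺ `Base` invertible
in `D₀`; isomorphism ⟺ `Base` invertible, `deg_Fr = 1` and `c · A_L = A_K|_L` (`isIso_iff`); and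
the first claim of Ex. 3.3 (ii): "an object of `C` is isotropic [[FrdI] Def. 1.2 (iv)] if and only
if it is naively isotropic" for `C₀` (`isIsotropic_iff_isNaivelyIsotropic`).
-/

namespace Literature.AlgebraicGeometry.Frobenioids

open CategoryTheory Set Function Topology
open scoped Pointwise

noncomputable section

namespace ArchFrd

/-! ### `D₀`: inverses do not change the Galois twist -/

namespace D0

/-- `Spec ℂ → Spec ℝ` is not an isomorphism of `D₀`. [cite: MochizukiFrdII2008, §3 p.23] -/
theorem not_isIso_toRealHom : ¬ IsIso toRealHom := fun _ => not_mono_toRealHom inferInstance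

/-- An isomorphism of `D₀` out of `Spec ℂ` lands in `Spec ℂ`. [cite: MochizukiFrdII2008, §3 p.23] -/
theorem eq_of_isIso {L K : D0} (f : L ⟶ K) [IsIso f] : L = K := by
  cases f with
  | idReal => rfl
  | toReal => exact absurd (show IsIso toRealHom from ‹_›) not_isIso_toRealHom
  | gal σ => rfl

/-- The inverse of an isomorphism of `D₀` acts on scalars like the isomorphism itself.
[cite: MochizukiFrdII2008, Def 3.1 (i) p.23] -/
theorem act_inv {L K : D0} (f : L ⟶ K) [IsIso f] : (inv f).act = f.act := by
  unfold Hom.act; rw [twists_inv]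

end D0

namespace C0

variable {X Y Z : C0}

/-! ### The structure functor `C₀ → F_{Φ₀}` in coordinates -/

/-- `Base` of [FrdI] Def. 1.1 (iv) for `C₀ → F_{Φ₀}` is `Base`. [cite: MochizukiFrdII2008, Ex 3.3 (i) p.28] -/
@[simp] theorem pf_base (φ : X ⟶ Y) : PreFrobenioid.Base toElem φ = Base φ := rfl

/-- `deg_Fr` of [FrdI] Def. 1.1 (iv) for `C₀ → F_{Φ₀}` is `degFr`. [cite: MochizukiFrdII2008, Ex 3.3 (i) p.28] -/
@[simp] theorem pf_degFr (φ : X ⟶ Y) : PreFrobenioid.degFr toElem φ = degFr φ := rfl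

/-- `Div` of [FrdI] Def. 1.1 (iv) for `C₀ → F_{Φ₀}` is `div`. [cite: MochizukiFrdII2008, Ex 3.3 (i) p.28] -/
@[simp] theorem pf_div (φ : X ⟶ Y) : PreFrobenioid.Div toElem φ = div φ := rfl

/-- The base object of `X` for `C₀ → F_{Φ₀}` is `X.base`. [cite: MochizukiFrdII2008, Ex 3.3 (i) p.28] -/
@[simp] theorem pf_baseObj (X : C0) : PreFrobenioid.baseObj toElem X = X.base := rfl

/-! ### Building morphisms of `C₀` from the criterion -/

/-- A morphism of `C₀` from data `(f, d, c)` satisfying the angular and radial conditions of the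
criterion (`AngularRegion.smul_carrier_pow_subset_iff`) towards the base-changed region `A_K|_L`
(Ex. 3.3 (i) (a)(b)(c)). Stated as an existence with all three coordinates pinned down.
[cite: MochizukiFrdII2008, Ex 3.3 (i) p.27] -/
theorem exists_hom (X Y : C0) (f : X.base ⟶ Y.base) (d : ℕ+) {c : ℂˣ} (hc : c ∈ D0.scalars X.base)
    {A' : AngularRegion ℂ} (hA' : A'.carrier = pullRegion Y f)
    (hdir : unitPart ℂ c • X.region.dir ^ (d : ℕ) ⊆ A'.dir)
    (htip : ‖(c : ℂ)‖ * X.tip ^ (d : ℕ) ≤ (A'.tip : ℝ)) :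
    ∃ φ : X ⟶ Y, Base φ = f ∧ degFr φ = d ∧ scalar φ = c := by
  refine ⟨⟨f, d, c, hc, ?_⟩, rfl, rfl, rfl⟩
  rw [← hA', ← d.natPred_add_one]
  rw [← d.natPred_add_one] at hdir htip
  exact (X.region.smul_carrier_pow_subset_iff A' c d.natPred).2
    ⟨hdir, (X.region.absHom_mul_pow_le_iff A' c _).2 htip⟩

/-- The angular and radial conditions satisfied by the data of any morphism of `C₀`, relative to the
base-changed region `A_K|_L`. [cite: MochizukiFrdII2008, Ex 3.3 (i) p.27] -/
theorem hom_conditions (φ : X ⟶ Y) {A' : AngularRegion ℂ} (hA' : A'.carrier = pullRegion Y (Base φ)) :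
    unitPart ℂ (scalar φ) • X.region.dir ^ (degFr φ : ℕ) ⊆ A'.dir ∧
      ‖(scalar φ : ℂ)‖ * X.tip ^ (degFr φ : ℕ) ≤ (A'.tip : ℝ) := by
  have h := φ.mapsTo
  change scalar φ • X.region.carrier ^ (degFr φ : ℕ) ⊆ pullRegion Y (Base φ) at h
  rw [← hA', ← (degFr φ).natPred_add_one] at h
  obtain ⟨h₁, h₂⟩ := (X.region.smul_carrier_pow_subset_iff A' _ _).1 h
  rw [(degFr φ).natPred_add_one] at h₁ h₂
  exact ⟨h₁, (X.region.absHom_mul_pow_le_iff A' _ _).1 h₂⟩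

/-! ### Linear, isometric, base-isomorphic (Def. 1.2 (i)(ii)) -/

/-- Linear ⟺ `deg_Fr = 1`. [cite: MochizukiFrdII2008, Ex 3.3 (i) p.27] -/
theorem isLinear_iff (φ : X ⟶ Y) : PreFrobenioid.IsLinear toElem φ ↔ degFr φ = 1 := Iff.rfl

/-- Base-isomorphism ⟺ `Base(φ)` is an isomorphism of `D₀`. [cite: MochizukiFrdII2008, Ex 3.3 (i) p.27] -/
theorem isBaseIso_iff (φ : X ⟶ Y) : PreFrobenioid.IsBaseIso toElem φ ↔ IsIso (Base φ) := Iff.rfl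

/-- `Div(φ) = 0 ⟺ ratio(φ) = 1`. [cite: MochizukiFrdII2008, Ex 3.3 (i) p.28] -/
theorem div_eq_one_iff (φ : X ⟶ Y) : div φ = 1 ↔ ratio φ = 1 := by
  constructor
  · intro h
    have h' : ((Multiplicative.toAdd (div φ) : NNReal) : ℝ) = 0 := by rw [h]; rfl
    rw [coe_toAdd_div] at h'
    rcases Real.log_eq_zero.mp h' with h0 | h1 | hm1
    · exact absurd h0 (ratio_pos φ).ne'
    · exact h1
    · linarith [ratio_pos φ]
  · intro h
    apply Multiplicative.toAdd.injective
    apply NNReal.eq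
    rw [coe_toAdd_div, h, Real.log_one]
    rfl

/-- **Isometry in coordinates**: `Div(φ) = 0` ⟺ `|c| · tip(A_L)^{deg_Fr} = tip(A_K)`.
[cite: MochizukiFrdII2008, Ex 3.3 (i) p.28] -/
theorem isIsometry_iff (φ : X ⟶ Y) :
    PreFrobenioid.IsIsometry toElem φ ↔ ‖(scalar φ : ℂ)‖ * X.tip ^ (degFr φ : ℕ) = Y.tip := by
  change div φ = 1 ↔ _
  rw [div_eq_one_iff]
  unfold ratio
  have hpos : 0 < ‖(scalar φ : ℂ)‖ * X.tip ^ (degFr φ : ℕ) :=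
    mul_pos (norm_pos_iff.mpr (scalar φ).ne_zero) (pow_pos X.tip_pos _)
  rw [div_eq_one_iff_eq hpos.ne', eq_comm]

/-- The tip of `X` is the tip of its region (bookkeeping between `ℝ_{>0}` and `ℝ`).
[cite: MochizukiFrdII2008, Def 3.1 (iii) p.24] -/
theorem tip_eq (X : C0) : X.tip = (X.region.tip : ℝ) := rfl

/-! ### Isomorphisms of `C₀` -/

/-- The scalar relation forced by `φ ≫ ψ = 𝟙`. [cite: MochizukiFrdII2008, Ex 3.3 (i) p.27] -/
theorem scalar_of_comp_eq_id {φ : X ⟶ Y} {ψ : Y ⟶ X} (h : φ ≫ ψ = 𝟙 X) :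
    (Base φ).act (scalar ψ) * scalar φ ^ (degFr ψ : ℕ) = 1 := by
  have := congrArg scalar h
  rwa [scalar_comp', scalar_id'] at this

/-- The Galois twist of `Base(φ)` applied to a smul of a set of `ℂ^×`.
[cite: MochizukiFrdII2008, Def 3.1 (iv) p.24] -/
theorem act_image_smul {L K : D0} (f : L ⟶ K) (c : ℂˣ) (S : Set ℂˣ) :
    f.act '' (c • S) = f.act c • f.act '' S := by
  ext u
  simp only [Set.mem_image, Set.mem_smul_set, smul_eq_mul]
  constructor
  · rintro ⟨_, ⟨v, hv, rfl⟩, rfl⟩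
    exact ⟨f.act v, ⟨v, hv, rfl⟩, (map_mul _ _ _).symm⟩
  · rintro ⟨_, ⟨v, hv, rfl⟩, rfl⟩
    exact ⟨c * v, ⟨v, hv, rfl⟩, map_mul _ _ _⟩

/-- The Galois twist is an involution on sets. [cite: MochizukiFrdII2008, Def 3.1 (iv) p.24] -/
theorem act_image_act_image {L K : D0} (f : L ⟶ K) (S : Set ℂˣ) : f.act '' (f.act '' S) = S := by
  rw [Set.image_image]
  conv_rhs => rw [← Set.image_id S]
  exact Set.image_congr fun u _ => D0.galAct_galAct _ u

/-- **Isomorphisms of `C₀`, sufficiency**: a morphism `(f, 1, c)` with `f` invertible in `D₀` and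
`c · A_L = A_K|_L` (equality in datum (c)) is an isomorphism; its inverse is `(f⁻¹, 1, f(c)⁻¹)`.
[cite: MochizukiFrdII2008, Ex 3.3 (i) p.27] -/
theorem isIso_of (φ : X ⟶ Y) [hf : IsIso (Base φ)] (hd : degFr φ = 1)
    (hfull : scalar φ • X.region.carrier = pullRegion Y (Base φ)) : IsIso φ := by
  -- the pulled-back image: `f(A_L) = f(c)⁻¹ · A_K`
  have himg : (Base φ).act '' X.region.carrier = (Base φ).act (scalar φ)⁻¹ • Y.region.carrier := by
    have := congrArg (fun S => (Base φ).act '' S) hfull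
    rw [act_image_smul] at this
    change (Base φ).act (scalar φ) • (Base φ).act '' X.region.carrier =
      (Base φ).act '' ((Base φ).act '' Y.region.carrier) at this
    rw [act_image_act_image] at this
    rw [← this, smul_smul, ← map_mul, inv_mul_cancel, map_one, one_smul]
  let ψ : Y ⟶ X :=
    { base := inv (Base φ)
      degFr := 1
      scalar := (Base φ).act (scalar φ)⁻¹
      scalar_mem := by
        rw [← D0.act_inv (Base φ)]
        exact act_mem_scalars _ (inv_mem φ.scalar_mem)
      mapsTo := by
        rw [PNat.one_coe, pow_one]
        change _ ⊆ (inv (Base φ)).act '' X.region.carrier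
        rw [D0.act_inv, himg] }
  refine ⟨ψ, ?_, ?_⟩
  · refine hom_ext ?_ ?_ ?_
    · change Base φ ≫ inv (Base φ) = 𝟙 _
      exact IsIso.hom_inv_id _
    · change degFr φ * 1 = 1
      rw [hd, mul_one]
    · change (Base φ).act ((Base φ).act (scalar φ)⁻¹) * scalar φ ^ ((1 : ℕ+) : ℕ) = 1
      rw [D0.galAct_galAct, PNat.one_coe, pow_one, inv_mul_cancel]
  · refine hom_ext ?_ ?_ ?_
    · change inv (Base φ) ≫ Base φ = 𝟙 _
      exact IsIso.inv_hom_id _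
    · change 1 * degFr φ = 1
      rw [hd, mul_one]
    · change (inv (Base φ)).act (scalar φ) * ((Base φ).act (scalar φ)⁻¹) ^ (degFr φ : ℕ) = 1
      rw [D0.act_inv, hd, PNat.one_coe, pow_one, ← map_mul, mul_inv_cancel, map_one]

/-- **Isomorphisms of `C₀`, necessity**: an isomorphism `φ` has `Base(φ)` invertible, `deg_Fr(φ) = 1`
and `c · A_L = A_K|_L`. [cite: MochizukiFrdII2008, Ex 3.3 (i) p.27] -/
theorem of_isIso (φ : X ⟶ Y) [IsIso φ] :
    IsIso (Base φ) ∧ degFr φ = 1 ∧ scalar φ • X.region.carrier = pullRegion Y (Base φ) := by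
  have hb : IsIso (Base φ) := PreFrobenioid.isBaseIso_of_isIso toElem φ
  have hd : degFr φ = 1 := PreFrobenioid.isLinear_of_isIso toElem φ
  refine ⟨hb, hd, le_antisymm ?_ ?_⟩
  · have h := φ.mapsTo
    change scalar φ • X.region.carrier ^ (degFr φ : ℕ) ⊆ pullRegion Y (Base φ) at h
    rwa [hd, PNat.one_coe, pow_one] at h
  · -- from the data of the inverse
    have hd' : degFr (inv φ) = 1 := PreFrobenioid.isLinear_of_isIso toElem (inv φ)
    have hs := scalar_of_comp_eq_id (IsIso.hom_inv_id φ)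
    rw [hd', PNat.one_coe, pow_one] at hs
    have hm := (inv φ).mapsTo
    change scalar (inv φ) • Y.region.carrier ^ (degFr (inv φ) : ℕ) ⊆
      (Base (inv φ)).act '' X.region.carrier at hm
    rw [hd', PNat.one_coe, pow_one] at hm
    have hbinv : Base (inv φ) = inv (Base φ) := by
      apply IsIso.eq_inv_of_hom_inv_id
      change Base (φ ≫ inv φ) = 𝟙 _
      rw [IsIso.hom_inv_id]; rfl
    rw [hbinv, D0.act_inv] at hm
    -- apply the twist of `Base φ`
    have hm' := Set.image_mono (f := (Base φ).act) hm
    rw [act_image_act_image, act_image_smul] at hm'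
    -- `f(c') = c⁻¹`
    have hc' : (Base φ).act (scalar (inv φ)) = (scalar φ)⁻¹ := eq_inv_of_mul_eq_one_left hs
    rw [hc'] at hm'
    exact Set.subset_smul_set_iff.mpr hm'

/-- **Isomorphisms of `C₀`**: `φ = (f, d, c)` is an isomorphism iff `f` is an isomorphism of `D₀`,
`d = 1` and `c · A_L = A_K|_L`. [cite: MochizukiFrdII2008, Ex 3.3 (i) p.27] -/
theorem isIso_iff (φ : X ⟶ Y) :
    IsIso φ ↔ IsIso (Base φ) ∧ degFr φ = 1 ∧ scalar φ • X.region.carrier = pullRegion Y (Base φ) :=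
  ⟨fun _ => of_isIso φ, fun ⟨h₁, h₂, h₃⟩ => @isIso_of _ _ φ h₁ h₂ h₃⟩

/-- **An isometric pre-step whose angular image fills the target is an isomorphism**: for a pre-step
`φ = (f, 1, c)` with `|c| tip = tip'` and `(c/|c|) · B ⊇ f-twist of B'`, `φ` is an isomorphism.
[cite: MochizukiFrdII2008, Ex 3.3 (ii) p.28] -/
theorem isIso_of_isometry_of_dir (φ : X ⟶ Y) (hpre : PreFrobenioid.IsPreStep toElem φ)
    (hiso : PreFrobenioid.IsIsometry toElem φ) {A' : AngularRegion ℂ}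
    (hA' : A'.carrier = pullRegion Y (Base φ)) (hA't : A'.tip = Y.region.tip)
    (hdir : A'.dir ⊆ unitPart ℂ (scalar φ) • X.region.dir) : IsIso φ := by
  have hd : degFr φ = 1 := hpre.1
  haveI : IsIso (Base φ) := hpre.2
  have hiso_eq : ‖(scalar φ : ℂ)‖ * X.tip = Y.tip := by
    have := (isIsometry_iff φ).1 hiso
    rwa [hd, PNat.one_coe, pow_one] at this
  refine isIso_of φ hd (le_antisymm ?_ ?_)
  · have h := φ.mapsTo
    change scalar φ • X.region.carrier ^ (degFr φ : ℕ) ⊆ pullRegion Y (Base φ) at h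
    rwa [hd, PNat.one_coe, pow_one] at h
  · rw [← hA', Set.subset_smul_set_iff]
    have := (A'.smul_carrier_pow_subset_iff X.region (scalar φ)⁻¹ 0).2
    rw [zero_add, pow_one, pow_one, pow_one] at this
    refine this ⟨?_, le_of_eq ?_⟩
    · rw [unitPart_inv]
      exact Set.subset_smul_set_iff.mp hdir
    · have ht : absHom ℂ (scalar φ) * X.region.tip = A'.tip := by
        apply Subtype.ext
        rw [Positive.val_mul, coe_absHom, hA't, ← tip_eq, ← tip_eq, ← hiso_eq]
      rw [map_inv, ← ht, inv_mul_cancel_left]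

end C0

end ArchFrd

end

end Literature.AlgebraicGeometry.Frobenioids
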